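import Summits.Schanuel.Schanuel.Theorems.ZilberEacComplexMovingPolydisc
import HarnessLib

/-!
# The moving-polydisc perturbation theorem, local form

`exists_exp_eq_poly_add_near_latticeCentre` (`ZilberEacComplexMovingPolydisc.lean`) asks the
perturbations `Pⱼ` to be ENTIRE and independent of `m`, and to tend to `0` absolutely. For
branches of algebraic functions (e.g. `xₙ = √P(x')` over a quadric cover whose root is imaginary
to leading order, `ZilberEacComplexQuadricCover.lean`) one needs perturbations `P_{m,j}` that are
only holomorphic on the unit polydisc around the lattice centre `x₀(m)` and small RELATIVE to the
fibre size `|Aⱼ(2πi m q)| ≍ m^{dⱼ}`. This file proves that form, from the contraction lemma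
`Literature.NumberTheory.Transcendental.ExpDominant.exists_exp_eq_one_add`
(D'Aquino–Fornasiero–Terzo 2018 / Brownawell–Masser 2017 Newton step).

* `exists_exp_eq_add_local` — `exp(x₀ⱼ + ξⱼ) = αⱼ + Pⱼ(x₀ + ξ)` is solvable with `‖ξ‖ ≤ 1/2` when
  `Pⱼ` is holomorphic on the open unit polydisc around `x₀` with `‖Pⱼ‖ ≤ ‖αⱼ‖/(16(s+1))`;
* `exists_exp_eq_poly_add_near_latticeCentre_local` — the moving-polydisc theorem for
  `m`-dependent local perturbations with `‖P_{m,j}‖ ≤ θ m^{dⱼ}` (every `θ > 0`, large `m`).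

HONEST FRAMING: infrastructure for modest new sub-rungs of EAC; nothing here bears on Schanuel's
conjecture.
-/

noncomputable section

open Complex MvPolynomial Metric Set Filter Topology

set_option linter.dupNamespace false

namespace Summit.Schanuel.Schanuel.Theorems

/-- **Local contraction step.** If `exp (x₀ⱼ) = αⱼ ≠ 0`, the `Pⱼ` are holomorphic on the open unit
polydisc around `x₀` and bounded there by `‖αⱼ‖ / (16 (s + 1))`, then the system
`exp (x₀ⱼ + ξⱼ) = αⱼ + Pⱼ(x₀ + ξ)` (`j < s`) has a solution with `‖ξ‖ ≤ 1/2`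
(`Literature.NumberTheory.Transcendental.ExpDominant.exists_exp_eq_one_add` with
`gⱼ(ξ) = Pⱼ(x₀ + ξ)/αⱼ`). [cite: DaquinoFornasieroTerzo2017, Lemma 2.2 (contraction step)] -/
theorem exists_exp_eq_add_local {s : ℕ} (x₀ α : Fin s → ℂ) (P : Fin s → (Fin s → ℂ) → ℂ)
    (hα : ∀ j, exp (x₀ j) = α j) (hα0 : ∀ j, α j ≠ 0)
    (hP : ∀ j, DifferentiableOn ℂ (P j) (ball x₀ 1))
    (hPb : ∀ j, ∀ ξ : Fin s → ℂ, ‖ξ‖ < 1 → ‖P j (x₀ + ξ)‖ ≤ ‖α j‖ / (16 * (s + 1))) :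
    ∃ ξ : Fin s → ℂ, ‖ξ‖ ≤ 1 / 2 ∧ ∀ j, exp (x₀ j + ξ j) = α j + P j (x₀ + ξ) := by
  set g : Fin s → (Fin s → ℂ) → ℂ := fun j ξ => P j (x₀ + ξ) / α j with hg
  have hmaps : MapsTo (fun ξ : Fin s → ℂ => x₀ + ξ) (ball 0 1) (ball x₀ 1) := by
    intro ξ hξ
    rw [mem_ball, dist_zero_right] at hξ
    rwa [mem_ball, dist_eq_norm, add_sub_cancel_left]
  have hgdiff : ∀ j, DifferentiableOn ℂ (g j) (ball 0 1) := by
    intro j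
    have h1 : DifferentiableOn ℂ (fun ξ : Fin s → ℂ => P j (x₀ + ξ)) (ball 0 1) :=
      (hP j).comp ((differentiable_const _).add differentiable_id).differentiableOn hmaps
    refine (h1.mul_const (α j)⁻¹).congr fun ξ _ => ?_
    show P j (x₀ + ξ) / α j = P j (x₀ + ξ) * (α j)⁻¹
    rw [div_eq_mul_inv]
  have hgbound : ∀ j, ∀ ξ ∈ ball (0 : Fin s → ℂ) 1, ‖g j ξ‖ ≤ 1 / (16 * (s + 1)) := by
    intro j ξ hξ
    rw [mem_ball, dist_zero_right] at hξ
    have hαpos : 0 < ‖α j‖ := norm_pos_iff.mpr (hα0 j)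
    show ‖P j (x₀ + ξ) / α j‖ ≤ _
    rw [norm_div, div_le_iff₀ hαpos]
    calc ‖P j (x₀ + ξ)‖ ≤ ‖α j‖ / (16 * (s + 1)) := hPb j ξ hξ
      _ = 1 / (16 * (s + 1)) * ‖α j‖ := by ring
  obtain ⟨ξ, hξ, hfix⟩ := Literature.NumberTheory.Transcendental.ExpDominant.exists_exp_eq_one_add
    g (ε := 1 / (16 * (s + 1))) (by positivity) (le_of_eq (by field_simp)) hgdiff hgbound
  refine ⟨ξ, hξ, fun j => ?_⟩
  rw [Complex.exp_add, hα j, hfix j, hg, mul_add, mul_one, mul_div_cancel₀ _ (hα0 j)]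

/-- **Moving-polydisc perturbation theorem, local form with relative smallness.** Let `q ∈ ℤˢ`,
`v = 2πi q`, `Aⱼ ∈ ℂ[x₁..xₛ]` with `(Aⱼ)_{dⱼ}(v) ≠ 0`, lattice centres
`x₀(m) = (m vⱼ + log Aⱼ(m v))ⱼ`. Let `P_{m,j}` be functions which, for all large `m`, are holomorphic
on the open unit polydisc around `x₀(m)`, and assume that for every `θ > 0`, for all large `m` and
all `‖ξ‖ < 1`, `‖P_{m,j}(x₀(m) + ξ)‖ ≤ θ m^{dⱼ}`. Then for all large `m` the system
`exp xⱼ = Aⱼ(x) + P_{m,j}(x)` (`j ≤ s`) has a solution with `‖x - x₀(m)‖ ≤ 1/2`. (Same proof as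
`exists_exp_eq_poly_add_near_latticeCentre`: `Aⱼ(x₀(m) + ξ) = Aⱼ(m v)(1 + O(log m/m))` and
`|Aⱼ(m v)| ≥ ½|(Aⱼ)_{dⱼ}(v)| m^{dⱼ}`.) [cite: DaquinoFornasieroTerzo2017, Lemma 2.2 (contraction step)] -/
theorem exists_exp_eq_poly_add_near_latticeCentre_local {s : ℕ} (q : Fin s → ℤ)
    (A : Fin s → MvPolynomial (Fin s) ℂ)
    (hA : ∀ j, eval (fun i => 2 * Real.pi * I * (q i : ℂ))
      (homogeneousComponent (A j).totalDegree (A j)) ≠ 0)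
    (P : ℕ → Fin s → (Fin s → ℂ) → ℂ)
    (hP : ∀ᶠ m : ℕ in atTop, ∀ j, DifferentiableOn ℂ (P m j)
      (ball (fun i => (m : ℂ) * (2 * Real.pi * I * (q i : ℂ)) +
        log (eval (fun k => (m : ℂ) * (2 * Real.pi * I * (q k : ℂ))) (A i))) 1))
    (hPsmall : ∀ j, ∀ θ : ℝ, 0 < θ → ∀ᶠ m : ℕ in atTop, ∀ ξ : Fin s → ℂ, ‖ξ‖ < 1 →
      ‖P m j ((fun i => (m : ℂ) * (2 * Real.pi * I * (q i : ℂ)) +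
          log (eval (fun k => (m : ℂ) * (2 * Real.pi * I * (q k : ℂ))) (A i))) + ξ)‖ ≤
        θ * (m : ℝ) ^ (A j).totalDegree) :
    ∀ᶠ m : ℕ in atTop, ∃ x : Fin s → ℂ,
      ‖x - fun i => (m : ℂ) * (2 * Real.pi * I * (q i : ℂ)) +
          log (eval (fun k => (m : ℂ) * (2 * Real.pi * I * (q k : ℂ))) (A i))‖ ≤ 1 / 2 ∧
      ∀ j, exp (x j) = eval x (A j) + P m j x := by
  classical
  set v : Fin s → ℂ := fun j => 2 * Real.pi * I * (q j : ℂ) with hv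
  set w : ℕ → Fin s → ℂ := fun m j => (m : ℂ) * v j with hw
  set α : ℕ → Fin s → ℂ := fun m j => eval (w m) (A j) with hαdef
  set x₀ : ℕ → Fin s → ℂ := fun m j => w m j + log (α m j) with hx₀
  have hκ : (0 : ℝ) < 1 / (64 * (s + 1)) := by positivity
  have hctrl := fun j => latticeValue_control (A j) v (hA j) hκ
  choose ρ hρ t₀ ht₀ hc using hctrl
  set a : Fin s → ℝ := fun j => ‖eval v (homogeneousComponent (A j).totalDegree (A j))‖ with ha
  have ha0 : ∀ j, 0 < a j := fun j => norm_pos_iff.mpr (hA j)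
  -- ### eventual facts
  have hev1 : ∀ᶠ m : ℕ in atTop, ∀ j, t₀ j ≤ (m : ℝ) :=
    eventually_all.2 fun j => tendsto_natCast_atTop_atTop.eventually_ge_atTop (t₀ j)
  have hev2 : ∀ δ : ℝ, 0 < δ → ∀ᶠ m : ℕ in atTop, ∀ i, ‖log (α m i)‖ ≤ δ * m := by
    intro δ hδ
    refine eventually_all.2 fun i => ?_
    have h1 : ∀ᶠ m : ℕ in atTop, t₀ i ≤ (m : ℝ) :=
      tendsto_natCast_atTop_atTop.eventually_ge_atTop (t₀ i)
    filter_upwards [h1, eventually_mul_log_add_le ((A i).totalDegree : ℝ)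
      (|Real.log (a i / 2)| + |Real.log (2 * a i)| + Real.pi) hδ] with m hm hm2
    obtain ⟨-, hlow, hupp, -⟩ := hc i m hm
    have hm1 : (1 : ℝ) ≤ m := (ht₀ i).trans hm
    exact (log_latticeValue_bounds (by have := ha0 i; positivity) hm1 hlow hupp).2.2.trans hm2
  have hev3 : ∀ᶠ m : ℕ in atTop, ∀ j, ‖fun i => log (α m i)‖ + 1 ≤ ρ j * m := by
    refine eventually_all.2 fun j => ?_
    filter_upwards [hev2 (ρ j / 2) (half_pos (hρ j)),
      (tendsto_natCast_atTop_atTop.const_mul_atTop (half_pos (hρ j))).eventually_ge_atTop 1]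
      with m hm hm'
    have : ‖fun i => log (α m i)‖ ≤ ρ j / 2 * m :=
      (pi_norm_le_iff_of_nonneg (by have := hρ j; positivity)).2 fun i => hm i
    linarith
  have hev4 : ∀ᶠ m : ℕ in atTop, ∀ j, ∀ ξ : Fin s → ℂ, ‖ξ‖ < 1 →
      ‖P m j (x₀ m + ξ)‖ ≤ a j / 2 / (64 * (s + 1)) * (m : ℝ) ^ (A j).totalDegree :=
    eventually_all.2 fun j => hPsmall j _ (by have := ha0 j; positivity)
  -- ### fix `m`
  filter_upwards [hev1, hev3, hev4, hP] with m hm1 hm3 hm4 hmP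
  have hfacts := fun j => hc j m (hm1 j)
  have hexpw : ∀ j, exp (w m j) = 1 := fun j => exp_natCast_mul_twoPiI_mul_intCast m (q j)
  have hα0 : ∀ j, α m j ≠ 0 := fun j => (hfacts j).1
  have hexpx₀ : ∀ j, exp (x₀ m j) = α m j := by
    intro j
    show exp (w m j + log (α m j)) = α m j
    rw [Complex.exp_add, hexpw j, one_mul, Complex.exp_log (hα0 j)]
  -- the total perturbation
  set Pt : Fin s → (Fin s → ℂ) → ℂ := fun j x => (eval x (A j) - α m j) + P m j x with hPt
  have hPtdiff : ∀ j, DifferentiableOn ℂ (Pt j) (ball (x₀ m) 1) := fun j =>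
    ((differentiable_mvPolynomial_eval (A j)).differentiableOn.sub_const _).add (hmP j)
  have hPtb : ∀ j, ∀ ξ : Fin s → ℂ, ‖ξ‖ < 1 → ‖Pt j (x₀ m + ξ)‖ ≤ ‖α m j‖ / (16 * (s + 1)) := by
    intro j ξ hξ
    have hη : ‖(fun i => log (α m i)) + ξ‖ ≤ ρ j * m := by
      refine (norm_add_le _ _).trans ?_
      have := hm3 j
      linarith [hξ.le]
    have hsplit : x₀ m + ξ = w m + ((fun i => log (α m i)) + ξ) := by
      funext i; simp only [hx₀, Pi.add_apply]; ring
    have h1 : ‖eval (x₀ m + ξ) (A j) - α m j‖ ≤ 1 / (64 * (s + 1)) * ‖α m j‖ := by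
      rw [hsplit]
      exact (hfacts j).2.2.2 _ hη
    have h2 : ‖P m j (x₀ m + ξ)‖ ≤ 1 / (64 * (s + 1)) * ‖α m j‖ := by
      refine (hm4 j ξ hξ).trans ?_
      have h3 : a j / 2 * (m : ℝ) ^ (A j).totalDegree ≤ ‖α m j‖ := (hfacts j).2.1
      have h4 : a j / 2 / (64 * (s + 1)) * (m : ℝ) ^ (A j).totalDegree =
          (a j / 2 * (m : ℝ) ^ (A j).totalDegree) / (64 * (s + 1)) := by ring
      rw [h4, div_le_iff₀ (by positivity)]
      calc a j / 2 * (m : ℝ) ^ (A j).totalDegree ≤ ‖α m j‖ := h3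
        _ = 1 / (64 * (s + 1)) * ‖α m j‖ * (64 * ((s : ℝ) + 1)) := by
            field_simp
    calc ‖Pt j (x₀ m + ξ)‖ ≤ ‖eval (x₀ m + ξ) (A j) - α m j‖ + ‖P m j (x₀ m + ξ)‖ :=
          norm_add_le _ _
      _ ≤ 1 / (64 * (s + 1)) * ‖α m j‖ + 1 / (64 * (s + 1)) * ‖α m j‖ := add_le_add h1 h2
      _ = ‖α m j‖ / (32 * (s + 1)) := by field_simp; ring
      _ ≤ ‖α m j‖ / (16 * (s + 1)) := by
          apply div_le_div_of_nonneg_left (norm_nonneg _) (by positivity)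
          nlinarith [(Nat.cast_nonneg s : (0 : ℝ) ≤ s)]
  obtain ⟨ξ, hξ, hsol⟩ := exists_exp_eq_add_local (x₀ m) (α m) Pt hexpx₀ hα0 hPtdiff hPtb
  refine ⟨x₀ m + ξ, ?_, fun j => ?_⟩
  · show ‖x₀ m + ξ - x₀ m‖ ≤ 1 / 2
    rwa [add_sub_cancel_left]
  · have h := hsol j
    simp only [Pi.add_apply] at h ⊢
    rw [h, hPt]
    ring

end Summit.Schanuel.Schanuel.Theorems
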